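import Summits.FinalStateConjecture.FinalStateConjecture.Theorems.PhotonSphereChannelsTameCensorshipOrientationDichotomyAux

/-!
# Route PhotonSphereChannels · crux `TameCensorship` (stmt-FinalStateConjecture-17431) · line `Sketch`, skeleton v7 ·
# STUB 19: the orientation dichotomy of converging Kerr-modelled charts

Closing file of the registered stub `stub_orientationDichotomy` (lead c3, 2026-08-17; `--supports
stmt-FinalStateConjecture-17431`). Clause (i) of K3 (`ExtremalChartFree`: no late chart from a boosted extremal
Kerr exterior with truncated `C²` deviation `→ 0`) carries no orientation token; the line splits it into its
FUTURE-GOING half for the development and for its time reverse. The present file supplies the dichotomy: for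
`M ≥ 0`, a smooth chart map `Ψ` from the boosted Kerr–Schild background `(Λ, c, M, a)` into a spacetime `𝓢`
whose truncated `C²` deviation tends to `0` for every truncation radius pushes the boosted Kerr–Schild time
vector `Λ V_{M,a}(Λ⁻¹(x − c))` forward to a vector field which is eventually FUTURE-directed on every truncated
slab `{t* = τ, r ≤ ρ}`, or eventually future-directed there for the reversed orientation `𝓢.reverse`.

Proof. `g_{M,a}(V, V) = −1 − 2H ≤ −1` on the exterior (`Kerr.bilin_timeVector_timeVector`,
`Kerr.scalarH_nonneg`) and `‖V‖ ≤ 5` there (`H ≤ M/r ≤ 1`, the Kerr–Schild null vector has norm `√2`), so the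
`C⁰` part of `truncDeviationCk … 2 n τ ≤ δ` (`enorm_deviation_le_truncDeviationCk`) with `δ ‖Λ‖² 25 ≤ ½` makes
`W = dΨ(ΛV)` timelike, `g(W, W) ≤ −½`, at every point of `{t* ≥ τ_n, r ≤ n}` for a monotone sequence of
thresholds `τ_n` (`partialSups`). The sign of the continuous function `f = g(T, W)` (`T` the orienting field
of `𝓢`; continuity by Mathlib's `ContMDiff.clm_bundle_apply₂` at regularity `0`, the tangent map of `Ψ` and
`OpensChart.contMDiffAt_section_iff`) is therefore constant on every connected subset of the good region
`{x | ∃ n, r(x) ≤ n ∧ τ_n ≤ t*(x)}`; any two good points lie on such a subset — two background time lines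
joined by a late copy of a path in the connected exterior slice `{y | r₊ < r(0, y)}`
(`Kerr.isConnected_setOf_lt_radius`) — so the sign is the same at all good points, and every truncated slab
`{t* = τ, r ≤ ρ}` with `τ ≥ τ_{⌈ρ⌉}` consists of good points. The Kerr–Schild bounds, the continuity of `f`, the
sign lemma and the coordinate bookkeeping are in the auxiliary file `…OrientationDichotomyAux.lean`.

References: B. O'Neill, *Semi-Riemannian Geometry* (1983), Ch. 5, Lemma 5.26–5.32 (timecones, time
orientation by a timelike field), p. 145 (time reversal); R. Kerr, A. Schild (1965); M. Visser,
arXiv:0706.0622, (32)–(35) (Kerr–Schild form).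
-/

set_option linter.dupNamespace false

noncomputable section

open Literature.Geometry.Lorentzian Set Filter TopologicalSpace Bundle
open scoped Manifold ContDiff Topology ENNReal NNReal

namespace Summit.FinalStateConjecture.FinalStateConjecture.Theorems.PhotonSphereChannels.TameCensorshipUnwind

open Summit.FinalStateConjecture.FinalStateConjecture.Theorems.PhotonSphereChannels.TameCensorshipCrush
  (enorm_deviation_le_truncDeviationCk)
open Summit.FinalStateConjecture.FinalStateConjecture.Theorems.KerrShieldedDataExist.Negative (radius_ofTimeSpace)
open Literature.Geometry.Lorentzian.LandauLifshitz (ofTimeSpace_eq_add_smul)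
open Literature.Geometry.Lorentzian.BoostedKerrLegs (apply_poincareInv_add)

/-! ## The dichotomy -/

-- the algebraic and the operator-norm instance paths on `E4 →L[ℝ] E4 →L[ℝ] ℝ` unify slowly
set_option synthInstance.maxHeartbeats 200000 in
set_option maxHeartbeats 1600000 in
/-- **STUB 19 — orientation dichotomy of converging Kerr-modelled charts** (registered statement of line
`Sketch`, skeleton v7, verbatim). For `M ≥ 0`, a smooth chart map `Ψ` from the boosted Kerr–Schild background
`(Λ, c, M, a)` into a spacetime `𝓢` whose truncated `C²` deviation tends to `0` for every truncation radius pushes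
the boosted Kerr–Schild time vector `Λ V_{M,a}(Λ⁻¹(x − c))` forward to a field which is EVENTUALLY
FUTURE-directed on every truncated slab, OR eventually future-directed there for the REVERSED orientation
`𝓢.reverse`. See the module docstring for the proof. [cite: ONeillSemiRiemannian1983, Ch. 5, Lemma 5.32 (p. 145)] -/
theorem stub_orientationDichotomy :
    ∀ (𝓢 : Spacetime.{0} 4) (Λ : lorentzGroup) (c : E4) (M a : ℝ), 0 ≤ M →
    ∀ (Ψ : (boostedKerrBackground Λ c M a).domain → 𝓢.carrier),
    ContMDiff 𝓘(ℝ, E4) (𝓡 4) ∞ Ψ →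
    (∀ R : ℝ, Filter.Tendsto (fun τ => 𝓢.truncDeviationCk (boostedKerrBackground Λ c M a) Ψ 2 R τ)
      Filter.atTop (nhds 0)) →
    (∀ ρ : ℝ, ∀ᶠ τ in Filter.atTop, ∀ x ∈ (boostedKerrBackground Λ c M a).truncTimeSlab ρ τ,
        𝓢.timeOrientation.IsFutureDirected (mfderiv 𝓘(ℝ, E4) (𝓡 4) Ψ x
          ((Λ : E4 ≃L[ℝ] E4) (Kerr.timeVector M a (poincareInv Λ c (x : E4)))))) ∨
    (∀ ρ : ℝ, ∀ᶠ τ in Filter.atTop, ∀ x ∈ (boostedKerrBackground Λ c M a).truncTimeSlab ρ τ,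
        𝓢.reverse.timeOrientation.IsFutureDirected (mfderiv 𝓘(ℝ, E4) (𝓡 4) Ψ x
          ((Λ : E4 ≃L[ℝ] E4) (Kerr.timeVector M a (poincareInv Λ c (x : E4)))))) := by
  intro 𝓢 Λ c M a hM
  -- notation (abstract the background and the boost BEFORE introducing the chart)
  set B : ModelBackground := boostedKerrBackground Λ c M a with hB
  set L : E4 ≃L[ℝ] E4 := (Λ : E4 ≃L[ℝ] E4) with hL
  intro Ψ hΨ hdev
  let V : B.domain → E4 := fun x => L (Kerr.timeVector M a (poincareInv Λ c (x : E4)))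
  let W : ∀ x : B.domain, TangentSpace (𝓡 4) (Ψ x) := fun x => mfderiv 𝓘(ℝ, E4) (𝓡 4) Ψ x (V x)
  let f : B.domain → ℝ := fun x =>
    𝓢.metric.val (Ψ x) (𝓢.timeOrientation.vectorField (Ψ x)) (W x)
  -- membership bookkeeping
  have hdom : ∀ x : B.domain, poincareInv Λ c (x : E4) ∈ Kerr.exterior M a := fun x =>
    mem_boostedKerrExterior.mp x.2
  have hmem : ∀ y : E4, y ∈ Kerr.exterior M a → L y + c ∈ B.domain := fun y hy => by
    show L y + c ∈ boostedKerrExterior Λ c M a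
    rw [mem_boostedKerrExterior, hL, poincareInv_boost_add]
    exact hy
  -- Step 1: the smallness constant
  set CV : ℝ := ‖(L : E4 →L[ℝ] E4)‖ * 5 with hCV
  have hCV0 : 0 ≤ CV := by positivity
  have hVle : ∀ x : B.domain, ‖V x‖ ≤ CV := fun x => norm_boostedTimeVector_le hM x
  set δ : ℝ := 1 / (2 * CV ^ 2 + 2) with hδ_def
  have hδ : 0 < δ := by positivity
  have hδCV : δ * CV ^ 2 ≤ 1 / 2 := by
    rw [hδ_def, div_mul_eq_mul_div, div_le_iff₀ (by positivity)]
    nlinarith [sq_nonneg CV]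
  -- Step 2: monotone thresholds `τthr n`, with `truncDeviationCk … 2 n τ ≤ δ` for `τ ≥ τthr n`
  have hthr : ∀ n : ℕ, ∃ N : ℝ, ∀ τ, N ≤ τ → 𝓢.truncDeviationCk B Ψ 2 n τ ≤ ENNReal.ofReal δ := by
    intro n
    obtain ⟨N, hN⟩ := (ENNReal.tendsto_atTop_zero.mp (hdev n)) (ENNReal.ofReal δ)
      (ENNReal.ofReal_pos.mpr hδ)
    exact ⟨N, fun τ hτ => hN τ hτ⟩
  choose N hN using hthr
  set τthr : ℕ → ℝ := fun n => partialSups N n with hτthr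
  have hτthr_mono : Monotone τthr := (partialSups N).monotone
  have hNτ : ∀ n, N n ≤ τthr n := fun n => le_partialSups N n
  -- the good region
  let Good : B.domain → Prop := fun x => ∃ n : ℕ, B.radius x.1 ≤ n ∧ τthr n ≤ B.time x.1
  -- Step 3: `W` is timelike with `g(W, W) ≤ -1/2` on the good region
  have hWW : ∀ x : B.domain, Good x → 𝓢.metric.val (Ψ x) (W x) (W x) ≤ -1 / 2 := by
    rintro x ⟨n, hrad, htime⟩
    have hslab : x ∈ B.truncTimeSlab n (B.time x.1) := ⟨rfl, hrad⟩
    have h1 : ‖𝓢.deviation B Ψ x‖ₑ ≤ 𝓢.truncDeviationCk B Ψ 2 n (B.time x.1) :=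
      enorm_deviation_le_truncDeviationCk Ψ 2 hslab
    have h2 : 𝓢.truncDeviationCk B Ψ 2 n (B.time x.1) ≤ ENNReal.ofReal δ :=
      hN n (B.time x.1) ((hNτ n).trans htime)
    have h3 := h1.trans h2
    rw [← ofReal_norm, ENNReal.ofReal_le_ofReal_iff hδ.le] at h3
    have hdev_eq : 𝓢.deviation B Ψ x (V x) (V x) =
        𝓢.metric.val (Ψ x) (W x) (W x) - B.bilin x.1 (V x) (V x) := by
      rw [Spacetime.deviation_apply]
    have hle : |𝓢.deviation B Ψ x (V x) (V x)| ≤ δ * CV ^ 2 := by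
      have h4 : |𝓢.deviation B Ψ x (V x) (V x)| ≤ ‖𝓢.deviation B Ψ x‖ * ‖V x‖ * ‖V x‖ := by
        rw [← Real.norm_eq_abs]
        exact (𝓢.deviation B Ψ x).le_opNorm₂ (V x) (V x)
      have h5 : ‖𝓢.deviation B Ψ x‖ * ‖V x‖ * ‖V x‖ ≤ δ * CV * CV := by
        have hV := hVle x
        have hV0 : 0 ≤ ‖V x‖ := norm_nonneg _
        exact mul_le_mul (mul_le_mul h3 hV hV0 hδ.le) hV hV0 (by positivity)
      nlinarith [h4, h5]
    have hbil : B.bilin x.1 (V x) (V x) ≤ -1 := bilin_boostedTimeVector_le hM x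
    have h6 := (abs_le.mp hle).2
    rw [hdev_eq] at h6
    linarith
  have hWt : ∀ x : B.domain, Good x → 𝓢.metric.IsTimelike (W x) := fun x hx => by
    rw [LorentzianMetric.isTimelike_iff]
    linarith [hWW x hx]
  -- Step 4: `f = g(T, W)` is continuous on the domain and non-zero on the good region
  have hfc : Continuous f :=
    stub_continuous_val_vectorField_mfderiv 𝓢 _ Ψ hΨ V fun x =>
      (OpensChart.contMDiffAt_iff x V
        (fun z : E4 => L (Kerr.timeVector M a (poincareInv Λ c z))) (fun _ => rfl)).2
        (contDiffAt_boostedTimeVector (hdom x))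
  have hfne : ∀ x : B.domain, Good x → f x ≠ 0 := fun x hx =>
    𝓢.metric.val_ne_zero_of_isTimelike_of_isCausal (𝓢.timeOrientation.isTimelike _) (hWt x hx).isCausal
  -- Step 5: the sign of `f` is the same at any two good points
  -- the exterior slice and its points, boosted into the domain
  set Slice : Set E3 := {s | max (Kerr.rPlus M a) 0 < Kerr.radius a (E4.ofTimeSpace 0 s)} with hSlice
  have hSlice_conn : IsConnected Slice := Kerr.isConnected_setOf_lt_radius a (le_max_right _ _)
  have hSlice_open : IsOpen Slice :=
    isOpen_lt continuous_const ((Kerr.continuous_radius a).comp (E4.continuous_ofTimeSpace 0))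
  have hSlice_path : IsPathConnected Slice := hSlice_open.isConnected_iff_isPathConnected.mp hSlice_conn
  have hmemTS : ∀ (t : ℝ) (s : E3), s ∈ Slice → E4.ofTimeSpace t s ∈ Kerr.exterior M a := by
    intro t s hs
    rw [Kerr.mem_exterior, radius_ofTimeSpace]
    exact hs
  -- the boosted point over `(t, s)`
  let pt : ∀ (t : ℝ) (s : E3), s ∈ Slice → B.domain := fun t s hs =>
    ⟨L (E4.ofTimeSpace t s) + c, hmem _ (hmemTS t s hs)⟩
  have hpt_time : ∀ (t : ℝ) (s : E3) (hs : s ∈ Slice), B.time (pt t s hs).1 = t := by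
    intro t s hs
    show poincareInv Λ c (L (E4.ofTimeSpace t s) + c) 0 = t
    rw [hL, poincareInv_boost_add]
    rfl
  have hpt_radius : ∀ (t : ℝ) (s : E3) (hs : s ∈ Slice),
      B.radius (pt t s hs).1 = Kerr.radius a (E4.ofTimeSpace 0 s) := by
    intro t s hs
    show Kerr.radius a (poincareInv Λ c (L (E4.ofTimeSpace t s) + c)) = _
    rw [hL, poincareInv_boost_add, radius_ofTimeSpace]
  -- every point of the domain is a boosted point
  have hrepr : ∀ x : B.domain, ∃ (t : ℝ) (s : E3) (hs : s ∈ Slice), x = pt t s hs ∧ t = B.time x.1 ∧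
      Kerr.radius a (E4.ofTimeSpace 0 s) = B.radius x.1 := by
    intro x
    have hy := hdom x
    set y := poincareInv Λ c (x : E4) with hy_def
    have hys : E4.ofTimeSpace (E4.time y) (E4.spatial y) = y := E4.ofTimeSpace_time_spatial y
    have hs : E4.spatial y ∈ Slice := by
      show max (Kerr.rPlus M a) 0 < Kerr.radius a (E4.ofTimeSpace 0 (E4.spatial y))
      rw [← radius_ofTimeSpace a (E4.time y), hys]
      exact Kerr.mem_exterior.mp hy
    refine ⟨E4.time y, E4.spatial y, hs, ?_, rfl, ?_⟩
    · apply Subtype.ext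
      show (x : E4) = L (E4.ofTimeSpace (E4.time y) (E4.spatial y)) + c
      rw [hys, hy_def, hL, apply_poincareInv_add]
    · rw [← radius_ofTimeSpace a (E4.time y), hys]
      rfl
  -- continuity of the coordinate curves into the domain
  have hcont_time : ∀ (s : E3) (hs : s ∈ Slice), Continuous fun t : ℝ => pt t s hs := by
    intro s hs
    refine Continuous.subtype_mk ?_ _
    have : Continuous fun t : ℝ => E4.ofTimeSpace t s := by
      rw [show (fun t : ℝ => E4.ofTimeSpace t s) = fun t => E4.ofTimeSpace 0 s + t • E4.basisVector 0 from
        funext fun t => ofTimeSpace_eq_add_smul t s]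
      fun_prop
    exact (L.continuous.comp this).add continuous_const
  have hcont_path : ∀ (T : ℝ) (γ : unitInterval → E3) (hγ : Continuous γ) (hγS : ∀ σ, γ σ ∈ Slice),
      Continuous fun σ : unitInterval => pt T (γ σ) (hγS σ) := by
    intro T γ hγ hγS
    refine Continuous.subtype_mk ?_ _
    exact (L.continuous.comp ((E4.continuous_ofTimeSpace T).comp hγ)).add continuous_const
  have hagree : ∀ x₁ x₂ : B.domain, Good x₁ → Good x₂ → (f x₁ < 0 ↔ f x₂ < 0) := by
    intro x₁ x₂ hg₁ hg₂
    obtain ⟨n₁, hr₁, ht₁⟩ := hg₁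
    obtain ⟨n₂, hr₂, ht₂⟩ := hg₂
    obtain ⟨t₁, s₁, hs₁, hx₁, ht₁e, hr₁e⟩ := hrepr x₁
    obtain ⟨t₂, s₂, hs₂, hx₂, ht₂e, hr₂e⟩ := hrepr x₂
    -- a path in the slice from `s₁` to `s₂`, with bounded radius
    obtain ⟨γ, hγ⟩ := hSlice_path.joinedIn s₁ hs₁ s₂ hs₂
    obtain ⟨Rmax, hRmax⟩ : ∃ Rmax : ℝ, ∀ σ : unitInterval, Kerr.radius a (E4.ofTimeSpace 0 (γ σ)) ≤ Rmax := by
      have hc : Continuous fun σ : unitInterval => Kerr.radius a (E4.ofTimeSpace 0 (γ σ)) :=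
        (Kerr.continuous_radius a).comp ((E4.continuous_ofTimeSpace 0).comp γ.continuous)
      obtain ⟨Rmax, hR⟩ := (isCompact_range hc).bddAbove
      exact ⟨Rmax, fun σ => hR ⟨σ, rfl⟩⟩
    -- a common late index and time
    set n₃ : ℕ := max (max n₁ n₂) ⌈Rmax⌉₊ with hn₃
    set Tbig : ℝ := max (max t₁ t₂) (τthr n₃) with hTbig
    -- the three pieces
    set A : Set B.domain := Set.range fun σ : unitInterval => pt Tbig (γ σ) (hγ σ) with hA
    set B₁ : Set B.domain := (fun t : ℝ => pt t s₁ hs₁) '' Set.Icc t₁ Tbig with hB₁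
    set B₂ : Set B.domain := (fun t : ℝ => pt t s₂ hs₂) '' Set.Icc t₂ Tbig with hB₂
    have hA_conn : IsPreconnected A :=
      (isPreconnected_range (hcont_path Tbig γ γ.continuous hγ))
    have hB₁_conn : IsPreconnected B₁ := isPreconnected_Icc.image _ (hcont_time s₁ hs₁).continuousOn
    have hB₂_conn : IsPreconnected B₂ := isPreconnected_Icc.image _ (hcont_time s₂ hs₂).continuousOn
    have ht₁T : t₁ ≤ Tbig := (le_max_left _ _).trans (le_max_left _ _)
    have ht₂T : t₂ ≤ Tbig := (le_max_right _ _).trans (le_max_left _ _)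
    -- common points
    have hc₁ : pt Tbig s₁ hs₁ ∈ A ∩ B₁ := by
      refine ⟨⟨0, ?_⟩, ⟨Tbig, ⟨ht₁T, le_rfl⟩, rfl⟩⟩
      apply Subtype.ext
      show L (E4.ofTimeSpace Tbig (γ 0)) + c = L (E4.ofTimeSpace Tbig s₁) + c
      rw [γ.source]
    have hc₂ : pt Tbig s₂ hs₂ ∈ (A ∪ B₁) ∩ B₂ := by
      refine ⟨Or.inl ⟨1, ?_⟩, ⟨Tbig, ⟨ht₂T, le_rfl⟩, rfl⟩⟩
      apply Subtype.ext
      show L (E4.ofTimeSpace Tbig (γ 1)) + c = L (E4.ofTimeSpace Tbig s₂) + c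
      rw [γ.target]
    have hS_conn : IsPreconnected ((A ∪ B₁) ∪ B₂) :=
      IsPreconnected.union _ hc₂.1 hc₂.2 (IsPreconnected.union _ hc₁.1 hc₁.2 hA_conn hB₁_conn) hB₂_conn
    -- all points of the three pieces are good
    have hgood : ∀ p ∈ (A ∪ B₁) ∪ B₂, Good p := by
      rintro p ((⟨σ, rfl⟩ | ⟨t, ht, rfl⟩) | ⟨t, ht, rfl⟩)
      · refine ⟨n₃, ?_, ?_⟩
        · rw [hpt_radius _ _ (hγ σ)]
          calc Kerr.radius a (E4.ofTimeSpace 0 (γ σ)) ≤ Rmax := hRmax σ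
            _ ≤ ⌈Rmax⌉₊ := Nat.le_ceil Rmax
            _ ≤ (n₃ : ℝ) := by exact_mod_cast le_max_right _ _
        · rw [hpt_time _ _ (hγ σ)]
          exact le_max_right _ _
      · refine ⟨n₁, ?_, ?_⟩
        · rw [hpt_radius _ _ hs₁, hr₁e]
          exact hr₁
        · rw [hpt_time _ _ hs₁]
          exact (ht₁e ▸ ht₁).trans ht.1
      · refine ⟨n₂, ?_, ?_⟩
        · rw [hpt_radius _ _ hs₂, hr₂e]
          exact hr₂
        · rw [hpt_time _ _ hs₂]
          exact (ht₂e ▸ ht₂).trans ht.1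
    have hx₁S : x₁ ∈ (A ∪ B₁) ∪ B₂ := Or.inl (Or.inr ⟨t₁, ⟨le_rfl, ht₁T⟩, hx₁.symm⟩)
    have hx₂S : x₂ ∈ (A ∪ B₁) ∪ B₂ := Or.inr ⟨t₂, ⟨le_rfl, ht₂T⟩, hx₂.symm⟩
    exact neg_iff_neg_of_isPreconnected hS_conn hfc.continuousOn (fun p hp => hfne p (hgood p hp)) hx₁S hx₂S
  -- a reference good point
  obtain ⟨s₀, hs₀⟩ := hSlice_conn.nonempty
  set n₀ : ℕ := ⌈Kerr.radius a (E4.ofTimeSpace 0 s₀)⌉₊ with hn₀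
  have hgood₀ : Good (pt (τthr n₀) s₀ hs₀) := by
    refine ⟨n₀, ?_, ?_⟩
    · rw [hpt_radius _ _ hs₀]
      exact Nat.le_ceil _
    · rw [hpt_time _ _ hs₀]
  -- truncated slabs are eventually good
  have hev : ∀ ρ : ℝ, ∀ᶠ τ in Filter.atTop, ∀ x ∈ B.truncTimeSlab ρ τ, Good x := by
    intro ρ
    refine Filter.eventually_atTop.2 ⟨τthr ⌈ρ⌉₊, fun τ hτ x hx => ?_⟩
    obtain ⟨hxt, hxr⟩ := (ModelBackground.mem_truncTimeSlab).mp hx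
    exact ⟨⌈ρ⌉₊, hxr.trans (Nat.le_ceil ρ), hxt ▸ hτ⟩
  -- Step 6: conclude according to the sign at the reference point
  rcases lt_or_gt_of_ne (hfne _ hgood₀) with hneg | hpos
  · refine Or.inl fun ρ => (hev ρ).mono fun τ hτ x hx => ?_
    have hgx := hτ x hx
    exact ⟨(hWt x hgx).isCausal, (hagree x _ hgx hgood₀).2 hneg⟩
  · refine Or.inr fun ρ => (hev ρ).mono fun τ hτ x hx => ?_
    have hgx := hτ x hx
    rcases lt_or_gt_of_ne (hfne x hgx) with h | h
    · exact absurd ((hagree x _ hgx hgood₀).1 h) (not_lt.mpr hpos.le)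
    · exact (𝓢.timeOrientation.isFutureDirected_reverse_iff _).mpr ⟨(hWt x hgx).isCausal, h⟩

end Summit.FinalStateConjecture.FinalStateConjecture.Theorems.PhotonSphereChannels.TameCensorshipUnwind

end
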